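import Literature.Analysis.Convolution.OneSidedConvolutionPowers
import Mathlib.MeasureTheory.Integral.IntervalIntegral.Basic
import Mathlib.Topology.Order.Bornology
import HarnessLib

/-!
# The Dickman-type kernel `B_η = 𝟙 − exp_⋆(−μ_η)`, `μ_η(t) = 𝟙_{t ≥ η}/t`

Everything here is PROVED, in the one-sided convolution algebra of `OneSidedConvolution*.lean`.
For `η > 0` let `μ_η(t) = 1/t` (`t ≥ η`), `H_η = 𝟙_{[η,∞)}` (`= D μ_η`, `D` = multiplication by
`t`), `box_η = 𝟙_{[0,η)}`, and

  `B_η = ∑_{k=1}^{K} ((−1)^{k+1}/k!) μ_η^{⋆k}`,  `K = ⌈3/η⌉ + 1`  (`dkKernel`),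

which on the window `[0, Kη) ⊇ [0, 3]` is the density of `δ − exp_⋆(−μ_η)`; classically
`B_η(t) = ρ(t/η − 1)/t` with Dickman's `ρ` (FM Lemma 9.4), but `ρ` is never used here: all
properties are derived inside the convolution algebra.

* `id_mul_dkKernel` — the **Volterra equation** `t B(t) = H(t) − (B ⋆ H)(t)` (derivation rule);
* `sub_mul_dkB` — the **Dickman form** `(t − η) b(t) = (b ⋆ box)(t) = ∫_{t−η}^{t} b`, `b = t B`,
  obtained from the Volterra equation by pure algebra (`(t−η)(B⋆H) = B⋆R + b⋆H`, `R − H⋆box = H⋆H`);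
* `continuousOn_dkB`, `dkB_pos` (first-zero argument), `dkKernel_nonneg`, `dkB_le_one`,
  `dkB_antitoneOn`, `setIntegral_dkKernel_le_one` (`∫_0^X B ≤ 1`), the decay
  `dkKernel_le_decay : B(t) ≤ η²/(t(t−η)(t−2η))` on `[3η, 3]`, and the Lipschitz bounds
  `abs_dkB_sub_le` (`1/η`), `abs_dkKernel_sub_le` (`2/η²` on `[η, 3]`).

These feed Ford–Maynard's modified Liouville functions (`ModifiedLiouville.lean`; K. Ford,
J. Maynard, arXiv:2407.14368, §9.1, Lemmas 9.3–9.4, where the same bounds are obtained via `ρ`).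
-/

noncomputable section

namespace Literature.Analysis.Convolution

open MeasureTheory Set Finset

/-! ### The functions `μ_η(t) = 𝟙_{t ≥ η}/t`, `H_η = 𝟙_{[η,∞)}`, `box_η = 𝟙_{[0,η)}` -/

section Kernel

variable {η : ℝ}

/-- `μ_η(t) = 1/t` for `t ≥ η`, `0` otherwise. [folklore] -/
def muFn (η t : ℝ) : ℝ := if η ≤ t then 1 / t else 0

/-- The Heaviside step at `η`: `H_η = 𝟙_{[η, ∞)}` (`= D μ_η`, `D` = multiplication by `t`). [folklore] -/
def stepFn (η t : ℝ) : ℝ := if η ≤ t then 1 else 0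

/-- The box `𝟙_{[0, η)}`. [folklore] -/
def boxFn (η t : ℝ) : ℝ := if 0 ≤ t ∧ t < η then 1 else 0

/-- `μ_η(t) = 0` for `t < η`. [folklore] -/
theorem muFn_of_lt {t : ℝ} (h : t < η) : muFn η t = 0 := by simp [muFn, not_le.2 h]
/-- `μ_η(t) = 1/t` for `t ≥ η`. [folklore] -/
theorem muFn_of_le {t : ℝ} (h : η ≤ t) : muFn η t = 1 / t := by simp [muFn, h]
/-- `H_η(t) = 0` for `t < η`. [folklore] -/
theorem stepFn_of_lt {t : ℝ} (h : t < η) : stepFn η t = 0 := by simp [stepFn, not_le.2 h]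
/-- `H_η(t) = 1` for `t ≥ η`. [folklore] -/
theorem stepFn_of_le {t : ℝ} (h : η ≤ t) : stepFn η t = 1 := by simp [stepFn, h]

/-- `t μ_η(t) = H_η(t)` (`D μ_η = H_η`). [folklore] -/
theorem id_mul_muFn (hη : 0 < η) (t : ℝ) : t * muFn η t = stepFn η t := by
  by_cases h : η ≤ t
  · rw [muFn_of_le h, stepFn_of_le h]; field_simp [(hη.trans_le h).ne']
  · rw [muFn_of_lt (not_le.1 h), stepFn_of_lt (not_le.1 h), mul_zero]

/-- `μ_η` is locally bounded and measurable (bounded by `1/η`). [folklore] -/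
theorem locBdd_muFn (hη : 0 < η) : LocBdd (muFn η) := by
  refine ⟨Measurable.ite measurableSet_Ici (measurable_const.div measurable_id) measurable_const,
    fun A => ⟨1 / η, fun t _ => ?_⟩⟩
  by_cases h : η ≤ t
  · rw [muFn_of_le h, abs_of_pos (one_div_pos.2 (hη.trans_le h))]
    exact one_div_le_one_div_of_le hη h
  · rw [muFn_of_lt (not_le.1 h), abs_zero]; positivity

/-- `H_η` is locally bounded and measurable. [folklore] -/
theorem locBdd_stepFn (η : ℝ) : LocBdd (stepFn η) :=
  ⟨Measurable.ite measurableSet_Ici measurable_const measurable_const,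
    fun A => ⟨1, fun t _ => by unfold stepFn; split_ifs <;> simp⟩⟩

/-- `box_η` is locally bounded and measurable. [folklore] -/
theorem locBdd_boxFn (η : ℝ) : LocBdd (boxFn η) :=
  ⟨Measurable.ite (measurableSet_Ici.inter measurableSet_Iio) measurable_const measurable_const,
    fun A => ⟨1, fun t _ => by unfold boxFn; split_ifs <;> simp⟩⟩

/-- `μ_η ≥ 0`. [folklore] -/
theorem muFn_nonneg (hη : 0 < η) (t : ℝ) : 0 ≤ muFn η t := by
  by_cases h : η ≤ t
  · rw [muFn_of_le h]; exact (one_div_pos.2 (hη.trans_le h)).le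
  · rw [muFn_of_lt (not_le.1 h)]

/-- `(f ⋆ H_η)(t) = ∫_{0 < s ≤ t − η} f(s) ds`. [folklore] -/
theorem oconv_stepFn_eq (f : ℝ → ℝ) (hη : 0 < η) (t : ℝ) :
    oconv f (stepFn η) t = ∫ s in Set.Ioc 0 (t - η), f s := by
  rw [oconv]
  have : (fun s => f s * stepFn η (t - s)) = (Set.Iic (t - η)).indicator f := by
    funext s
    simp only [stepFn, Set.indicator, Set.mem_Iic]
    by_cases h : s ≤ t - η
    · rw [if_pos (by linarith), if_pos h, mul_one]
    · rw [if_neg (by linarith), if_neg h, mul_zero]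
  rw [this, setIntegral_indicator measurableSet_Iic]
  congr 1
  congr 1
  ext s
  simp only [Set.mem_inter_iff, Set.mem_Ioc, Set.mem_Iic]
  constructor
  · rintro ⟨⟨h1, _⟩, h3⟩; exact ⟨h1, h3⟩
  · rintro ⟨h1, h2⟩; exact ⟨⟨h1, by linarith⟩, h2⟩

/-- `(f ⋆ box_η)(t) = ∫_{t − η < s ≤ t} f(s) ds` for `t ≥ η`. [folklore] -/
theorem oconv_boxFn_eq (f : ℝ → ℝ) {t : ℝ} (ht : η ≤ t) :
    oconv f (boxFn η) t = ∫ s in Set.Ioc (t - η) t, f s := by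
  rw [oconv]
  have : (fun s => f s * boxFn η (t - s)) = (Set.Ioi (t - η)).indicator (fun s => f s * if s ≤ t then 1 else 0) := by
    funext s
    simp only [boxFn, Set.indicator, Set.mem_Ioi]
    by_cases h : t - η < s
    · rw [if_pos h]
      by_cases h2 : s ≤ t
      · rw [if_pos ⟨by linarith, by linarith⟩, if_pos h2]
      · rw [if_neg (fun h' => h2 (by linarith [h'.1])), if_neg h2]
    · rw [if_neg h, if_neg (fun h' => h (by linarith [h'.2]))]; simp
  rw [this, setIntegral_indicator measurableSet_Ioi]
  have hset : Set.Ioc 0 t ∩ Set.Ioi (t - η) = Set.Ioc (t - η) t := by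
    ext s
    simp only [Set.mem_inter_iff, Set.mem_Ioc, Set.mem_Ioi]
    constructor
    · rintro ⟨⟨_, h2⟩, h3⟩; exact ⟨h3, h2⟩
    · rintro ⟨h1, h2⟩; exact ⟨⟨by linarith, h2⟩, h1⟩
  rw [hset]
  refine setIntegral_congr_fun measurableSet_Ioc fun s hs => ?_
  simp [hs.2]

/-- `H_η ⋆ H_η = (t − 2η)⁺` (the ramp at `2η`). [folklore] -/
theorem oconv_stepFn_stepFn (hη : 0 < η) (t : ℝ) :
    oconv (stepFn η) (stepFn η) t = max (t - 2 * η) 0 := by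
  rw [oconv_stepFn_eq _ hη]
  have : (fun s => stepFn η s) = (Set.Ici η).indicator fun _ => (1 : ℝ) := by
    funext s; simp [stepFn, Set.indicator, Set.mem_Ici]
  rw [show (fun s => stepFn η s) = stepFn η from rfl] at this
  rw [this, setIntegral_indicator measurableSet_Ici, setIntegral_const, smul_eq_mul, mul_one]
  have hset : Set.Ioc 0 (t - η) ∩ Set.Ici η = Set.Icc η (t - η) := by
    ext s; simp only [Set.mem_inter_iff, Set.mem_Ioc, Set.mem_Ici, Set.mem_Icc]
    constructor
    · rintro ⟨⟨_, h2⟩, h3⟩; exact ⟨h3, h2⟩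
    · rintro ⟨h1, h2⟩; exact ⟨⟨hη.trans_le h1, h2⟩, h1⟩
  rw [hset, Measure.real, Real.volume_Icc]
  rcases le_or_gt (2 * η) t with h | h
  · rw [ENNReal.toReal_ofReal (by linarith), max_eq_left (by linarith)]; ring
  · rw [ENNReal.ofReal_of_nonpos (by linarith), max_eq_right (by linarith)]; simp

/-- `H_η ⋆ box_η = min(t − η, η)` for `t ≥ η`. [folklore] -/
theorem oconv_stepFn_boxFn (hη : 0 < η) {t : ℝ} (ht : η ≤ t) :
    oconv (stepFn η) (boxFn η) t = min (t - η) η := by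
  rw [oconv_boxFn_eq _ ht]
  have : stepFn η = (Set.Ici η).indicator fun _ => (1 : ℝ) := by
    funext s; simp [stepFn, Set.indicator, Set.mem_Ici]
  rw [this, setIntegral_indicator measurableSet_Ici, setIntegral_const, smul_eq_mul, mul_one]
  rcases le_or_gt η (t - η) with h | h
  · have hset : Set.Ioc (t - η) t ∩ Set.Ici η = Set.Ioc (t - η) t := by
      ext s; simp only [Set.mem_inter_iff, Set.mem_Ioc, Set.mem_Ici]
      constructor
      · rintro ⟨h1, _⟩; exact h1
      · rintro ⟨h1, h2⟩; exact ⟨⟨h1, h2⟩, by linarith⟩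
    rw [hset, Measure.real, Real.volume_Ioc, ENNReal.toReal_ofReal (by linarith), min_eq_right h]
    ring
  · have hset : Set.Ioc (t - η) t ∩ Set.Ici η = Set.Icc η t := by
      ext s; simp only [Set.mem_inter_iff, Set.mem_Ioc, Set.mem_Ici, Set.mem_Icc]
      constructor
      · rintro ⟨⟨_, h2⟩, h3⟩; exact ⟨h3, h2⟩
      · rintro ⟨h1, h2⟩; exact ⟨⟨by linarith, h2⟩, h1⟩
    rw [hset, Measure.real, Real.volume_Icc, ENNReal.toReal_ofReal (by linarith), min_eq_left h.le]

/-! ### The kernel `B_η = 𝟙 − exp_⋆(−μ_η)` (truncated series) and its Volterra equation -/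

/-- Truncation order `K = ⌈3/η⌉ + 1`: all identities below hold on the window `t < K η` (`⊇ [0, 3]`).
[folklore] -/
def dkOrder (η : ℝ) : ℕ := ⌈3 / η⌉₊ + 1

/-- The coefficients `(−1)^{k+1}/k!` of `1 − e^{−x} = ∑_{k ≥ 1} (−1)^{k+1} x^k/k!`. [folklore] -/
def dkCoeff (k : ℕ) : ℝ := (-1) ^ (k + 1) / k.factorial

/-- **The Dickman-type kernel** `B_η = ∑_{k=1}^{K} ((−1)^{k+1}/k!) μ_η^{⋆k}`: on the window
`[0, Kη) ⊇ [0, 3]` this is the density of `δ − exp_⋆(−μ_η)`, `μ_η(t) = 𝟙_{t ≥ η}/t`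
(classically `B_η(t) = ρ(t/η − 1)/t` with Dickman's `ρ`; we never use `ρ`). [folklore] -/
def dkKernel (η : ℝ) (t : ℝ) : ℝ := ∑ k ∈ Finset.Icc 1 (dkOrder η), dkCoeff k * cpow (muFn η) k t

/-- The window `[0, 3]` lies below `K η`: `3 < K η`. [folklore] -/
theorem dkOrder_mul_gt (hη : 0 < η) : 3 < (dkOrder η : ℝ) * η := by
  unfold dkOrder
  have h1 : (3 / η : ℝ) ≤ ⌈3 / η⌉₊ := Nat.le_ceil _
  push_cast
  calc (3 : ℝ) = 3 / η * η := by field_simp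
    _ < (⌈3 / η⌉₊ + 1) * η := by
        refine mul_lt_mul_of_pos_right (by linarith) hη

/-- `dkCoeff 1 = 1`. [folklore] -/
theorem dkCoeff_one : dkCoeff 1 = 1 := by simp [dkCoeff]

/-- `dkCoeff (k+1) (k+1) = −dkCoeff k` (the recursion `(−1)^{k+2}/(k+1)! · (k+1) = −(−1)^{k+1}/k!`). [folklore] -/
theorem dkCoeff_succ_mul (k : ℕ) : dkCoeff (k + 1) * (k + 1 : ℝ) = -dkCoeff k := by
  unfold dkCoeff
  rw [Nat.factorial_succ, pow_succ]
  push_cast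
  have hk : ((k.factorial : ℕ) : ℝ) ≠ 0 := by exact_mod_cast k.factorial_ne_zero
  have hk1 : (k + 1 : ℝ) ≠ 0 := by positivity
  field_simp

/-- `B_η` is locally bounded and measurable. [folklore] -/
theorem locBdd_dkKernel (hη : 0 < η) : LocBdd (dkKernel η) :=
  LocBdd.sum _ fun k _ => ((locBdd_muFn hη).cpow k).const_mul _

/-- `B_η = 0` on `(−∞, η)`. [folklore] -/
theorem dkKernel_of_lt (hη : 0 < η) {t : ℝ} (ht : t < η) : dkKernel η t = 0 := by
  unfold dkKernel
  refine Finset.sum_eq_zero fun k hk => ?_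
  have hk1 : 1 ≤ k := (Finset.mem_Icc.1 hk).1
  rw [cpow_eq_zero_of_lt (fun s hs => muFn_of_lt hs) hk1 (lt_of_lt_of_le ht ?_), mul_zero]
  have : (1 : ℝ) ≤ k := by exact_mod_cast hk1
  nlinarith

/-- `B_η(t) = 1/t` on `[η, 2η)`. [folklore] -/
theorem dkKernel_of_lt_two_mul (hη : 0 < η) {t : ℝ} (h1 : η ≤ t) (h2 : t < 2 * η) :
    dkKernel η t = 1 / t := by
  unfold dkKernel
  rw [show Finset.Icc 1 (dkOrder η) = Finset.Ico 1 (dkOrder η + 1) by rfl,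
    Finset.sum_eq_sum_Ico_succ_bot (by unfold dkOrder; omega), cpow_one, muFn_of_le h1,
    dkCoeff_one, one_mul, add_eq_left]
  refine Finset.sum_eq_zero fun k hk => ?_
  have hk2 : 2 ≤ k := (Finset.mem_Ico.1 hk).1
  rw [cpow_eq_zero_of_lt (fun s hs => muFn_of_lt hs) (by omega) (lt_of_lt_of_le h2 ?_), mul_zero]
  have : (2 : ℝ) ≤ k := by exact_mod_cast hk2
  nlinarith

/-- `D μ_η = H_η` as functions. [folklore] -/
theorem id_mul_muFn_eq (hη : 0 < η) : (fun t => t * muFn η t) = stepFn η :=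
  funext fun t => id_mul_muFn hη t

/-- **The Volterra equation of `B_η`**: `t B_η(t) = H_η(t) − (B_η ⋆ H_η)(t)` on the window
`t < K η`, i.e. `D B = Dμ − B ⋆ Dμ` — the derivation rule applied to `B = 𝟙 − exp_⋆(−μ)`.
[folklore] -/
theorem id_mul_dkKernel (hη : 0 < η) {t : ℝ} (ht : t < dkOrder η * η) :
    t * dkKernel η t = stepFn η t - oconv (dkKernel η) (stepFn η) t := by
  have hμ := locBdd_muFn hη
  have hK : 1 ≤ dkOrder η := by unfold dkOrder; omega
  set K := dkOrder η with hKdef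
  -- left side: `∑ c_k t μ^{⋆k}(t) = H(t) + ∑_{k'=1}^{K-1} c_{k'+1}(k'+1) (μ^{⋆k'} ⋆ H)(t)`
  have hL : t * dkKernel η t =
      stepFn η t - ∑ k ∈ Finset.Ico 1 K, dkCoeff k * oconv (cpow (muFn η) k) (stepFn η) t := by
    unfold dkKernel
    rw [Finset.mul_sum, show Finset.Icc 1 K = Finset.Ico 1 (K + 1) by rfl,
      Finset.sum_eq_sum_Ico_succ_bot (by omega), cpow_one, dkCoeff_one, one_mul, id_mul_muFn hη]
    congr 1
    -- shift the index
    rw [← Finset.sum_Ico_add' (c := 1), ← Finset.sum_neg_distrib]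
    refine Finset.sum_congr rfl fun k hk => ?_
    have hk1 : 1 ≤ k := (Finset.mem_Ico.1 hk).1
    rw [mul_left_comm, id_mul_cpow_succ hμ hk1, id_mul_muFn_eq hη, ← mul_assoc,
      dkCoeff_succ_mul]
    ring
  -- right side: `(B ⋆ H)(t) = ∑_{k=1}^{K} c_k (μ^{⋆k} ⋆ H)(t)` and the `k = K` term vanishes
  have hR : oconv (dkKernel η) (stepFn η) t =
      ∑ k ∈ Finset.Ico 1 K, dkCoeff k * oconv (cpow (muFn η) k) (stepFn η) t := by
    have h1 : dkKernel η = fun s => ∑ k ∈ Finset.Icc 1 K, (fun k s => dkCoeff k * cpow (muFn η) k s) k s := by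
      funext s; rfl
    rw [h1, oconv_sum_left _ (fun k _ => (hμ.cpow k).const_mul _) (locBdd_stepFn η)]
    simp only [oconv_const_mul_left]
    rw [show Finset.Icc 1 K = Finset.Ico 1 (K + 1) by rfl, Finset.sum_Ico_succ_top (by omega),
      add_eq_left, oconv_eq_zero_of_lt (a := K * η) (b := η)
        (fun s hs => cpow_eq_zero_of_lt (fun u hu => muFn_of_lt hu) hK hs)
        (fun s hs => stepFn_of_lt hs) (by linarith), mul_zero]
  rw [hL, hR]

/-- The function `b_η(t) = t B_η(t)` satisfies `b_η(t) = H_η(t) − ∫_{0<s≤t−η} B_η(s) ds` on the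
window. [folklore] -/
theorem id_mul_dkKernel_eq_sub_integral (hη : 0 < η) {t : ℝ} (ht : t < dkOrder η * η) :
    t * dkKernel η t = stepFn η t - ∫ s in Set.Ioc 0 (t - η), dkKernel η s := by
  rw [id_mul_dkKernel hη ht, oconv_stepFn_eq _ hη]

/-! ### The Dickman form `(t − η) b(t) = ∫_{t−η}^{t} b` — pure convolution algebra -/

/-- Subtraction in the first variable of `⋆`. [folklore] -/
theorem oconv_sub_left {f g h : ℝ → ℝ} (hf : LocBdd f) (hg : LocBdd g) (hh : LocBdd h) :
    oconv (fun t => f t - g t) h = fun x => oconv f h x - oconv g h x := by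
  have := oconv_add_left hf hg.neg hh
  simp only [← sub_eq_add_neg] at this
  rw [this]
  funext x
  rw [show (fun t => -g t) = fun t => (-1) * g t by funext t; ring, oconv_const_mul_left]
  ring

/-- Subtraction in the second variable of `⋆`. [folklore] -/
theorem oconv_sub_right {f g h : ℝ → ℝ} (hf : LocBdd f) (hg : LocBdd g) (hh : LocBdd h) :
    oconv f (fun t => g t - h t) = fun x => oconv f g x - oconv f h x := by
  rw [oconv_comm, oconv_sub_left hg hh hf, oconv_comm g f, oconv_comm h f]

/-- `(t − η)(f ⋆ H_η)(t) = (f ⋆ R_η)(t) + ((Df) ⋆ H_η)(t)` with the ramp `R_η(u) = (u − η) H_η(u)`.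
[folklore] -/
theorem sub_mul_oconv_stepFn {f : ℝ → ℝ} (hf : LocBdd f) (η t : ℝ) :
    (t - η) * oconv f (stepFn η) t =
      oconv f (fun u => (u - η) * stepFn η u) t + oconv (fun u => u * f u) (stepFn η) t := by
  have h1 := id_mul_oconv hf (locBdd_stepFn η) t
  have h2 : η * oconv f (stepFn η) t = oconv f (fun u => η * stepFn η u) t := by
    rw [oconv_const_mul_right]
  have h3 : oconv f (fun u => (u - η) * stepFn η u) t =
      oconv f (fun u => u * stepFn η u) t - oconv f (fun u => η * stepFn η u) t := by
    have := oconv_sub_right hf (locBdd_stepFn η).id_mul ((locBdd_stepFn η).const_mul η)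
    simp only [← sub_mul] at this
    rw [this]
  rw [sub_mul, h1, h2, h3]
  ring

/-- `R_η − H_η ⋆ box_η = H_η ⋆ H_η` (`= (t − 2η)⁺`). [folklore] -/
theorem ramp_sub_eq (hη : 0 < η) (u : ℝ) :
    (u - η) * stepFn η u - oconv (stepFn η) (boxFn η) u = oconv (stepFn η) (stepFn η) u := by
  rw [oconv_stepFn_stepFn hη]
  rcases le_or_gt η u with h | h
  · rw [oconv_stepFn_boxFn hη h, stepFn_of_le h, mul_one]
    rcases le_or_gt (u - η) η with h2 | h2
    · rw [min_eq_left h2, max_eq_right (by linarith)]; ring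
    · rw [min_eq_right h2.le, max_eq_left (by linarith)]; ring
  · rw [stepFn_of_lt h, mul_zero, max_eq_right (by linarith),
      oconv_eq_zero_of_lt (a := η) (b := 0) (fun s hs => stepFn_of_lt hs)
        (fun s hs => by simp [boxFn, not_le.2 hs]) (by linarith)]
    ring

/-- The function `b_η = D B_η`. [folklore] -/
def dkB (η t : ℝ) : ℝ := t * dkKernel η t

/-- `b_η = t B_η(t)` is locally bounded and measurable. [folklore] -/
theorem locBdd_dkB (hη : 0 < η) : LocBdd (dkB η) := (locBdd_dkKernel hη).id_mul

/-- `b_η = H_η − B_η ⋆ H_η` on the window. [folklore] -/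
theorem dkB_eq (hη : 0 < η) {t : ℝ} (ht : t < dkOrder η * η) :
    dkB η t = stepFn η t - oconv (dkKernel η) (stepFn η) t := id_mul_dkKernel hη ht

/-- **The Dickman form of the Volterra equation**: `(t − η) b_η(t) = (b_η ⋆ box_η)(t)` on the
window — obtained from `b = H − B ⋆ H` by convolution algebra alone
(`(t−η)(B⋆H) = B⋆R + b⋆H`, `R − H⋆box = H⋆H`). [folklore] -/
theorem sub_mul_dkB (hη : 0 < η) {t : ℝ} (ht : t < dkOrder η * η) :
    (t - η) * dkB η t = oconv (dkB η) (boxFn η) t := by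
  have hB := locBdd_dkKernel hη
  have hH := locBdd_stepFn η
  have hbox := locBdd_boxFn η
  have hb := locBdd_dkB hη
  have hramp : LocBdd (fun u => (u - η) * stepFn η u) := by
    have h0 := hH.id_mul.sub (hH.const_mul η)
    have heq : (fun u => u * stepFn η u - η * stepFn η u) = fun u => (u - η) * stepFn η u := by
      funext u; ring
    rw [heq] at h0
    exact h0
  -- `b = H − B ⋆ H` on `[0, t]`
  have hbeq : ∀ s ∈ Set.Icc 0 t, dkB η s = stepFn η s - oconv (dkKernel η) (stepFn η) s :=
    fun s hs => dkB_eq hη (lt_of_le_of_lt hs.2 ht)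
  -- left side
  have hL : (t - η) * dkB η t = (t - η) * stepFn η t - oconv (dkKernel η) (fun u => (u - η) * stepFn η u) t
      - oconv (dkB η) (stepFn η) t := by
    rw [dkB_eq hη ht, mul_sub, sub_mul_oconv_stepFn hB]
    rw [show (fun u => u * dkKernel η u) = dkB η from rfl]
    ring
  -- `b ⋆ H = (H − B⋆H) ⋆ H = H⋆H − B ⋆ (H⋆H)` at `t`
  have hbH : oconv (dkB η) (stepFn η) t =
      oconv (stepFn η) (stepFn η) t - oconv (dkKernel η) (oconv (stepFn η) (stepFn η)) t := by
    rw [oconv_congr_of_eqOn hbeq (fun s _ => rfl) le_rfl, oconv_sub_left hH (hB.oconv hH) hH,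
      oconv_assoc hB hH hH]
  -- `b ⋆ box = H⋆box − B ⋆ (H⋆box)` at `t`
  have hbbox : oconv (dkB η) (boxFn η) t =
      oconv (stepFn η) (boxFn η) t - oconv (dkKernel η) (oconv (stepFn η) (boxFn η)) t := by
    rw [oconv_congr_of_eqOn hbeq (fun s _ => rfl) le_rfl, oconv_sub_left hH (hB.oconv hH) hbox,
      oconv_assoc hB hH hbox]
  -- `H⋆H = R − H⋆box` inside `B ⋆ ·`
  have hHH : oconv (dkKernel η) (oconv (stepFn η) (stepFn η)) t =
      oconv (dkKernel η) (fun u => (u - η) * stepFn η u) t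
        - oconv (dkKernel η) (oconv (stepFn η) (boxFn η)) t := by
    have := oconv_sub_right hB hramp (hH.oconv hbox)
    rw [show oconv (dkKernel η) (fun u => (u - η) * stepFn η u) t
        - oconv (dkKernel η) (oconv (stepFn η) (boxFn η)) t
        = (fun x => oconv (dkKernel η) (fun u => (u - η) * stepFn η u) x
            - oconv (dkKernel η) (oconv (stepFn η) (boxFn η)) x) t from rfl, ← this]
    congr 1
    funext u
    exact (ramp_sub_eq hη u).symm
  rw [hL, hbH, hHH, hbbox, ← ramp_sub_eq hη t]
  ring

/-- `(t − η) b_η(t) = ∫_{t−η < s ≤ t} b_η(s) ds` for `η ≤ t < Kη`. [folklore] -/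
theorem sub_mul_dkB_eq_integral (hη : 0 < η) {t : ℝ} (h1 : η ≤ t) (ht : t < dkOrder η * η) :
    (t - η) * dkB η t = ∫ s in Set.Ioc (t - η) t, dkB η s := by
  rw [sub_mul_dkB hη ht, oconv_boxFn_eq _ h1]

/-! ### Continuity and positivity of `b_η`; bounds for `B_η` -/

/-- `3 < K η` (restated with the section variable). [folklore] -/
theorem three_lt_window (hη : 0 < η) : (3 : ℝ) < dkOrder η * η := dkOrder_mul_gt hη

/-- `b_η = 1` on `[η, 2η)`. [folklore] -/
theorem dkB_of_lt_two_mul (hη : 0 < η) {t : ℝ} (h1 : η ≤ t) (h2 : t < 2 * η) : dkB η t = 1 := by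
  rw [dkB, dkKernel_of_lt_two_mul hη h1 h2]
  field_simp [(hη.trans_le h1).ne']

/-- `b_η(t) = 1 − ∫_{0<s≤t−η} B_η` for `η ≤ t < Kη`. [folklore] -/
theorem dkB_eq_one_sub (hη : 0 < η) {t : ℝ} (h1 : η ≤ t) (ht : t < dkOrder η * η) :
    dkB η t = 1 - ∫ s in Set.Ioc 0 (t - η), dkKernel η s := by
  rw [dkB, id_mul_dkKernel_eq_sub_integral hη ht, stepFn_of_le h1]

/-- `b_η` is continuous on `[η, Kη)`. [folklore] -/
theorem continuousOn_dkB (hη : 0 < η) : ContinuousOn (dkB η) (Set.Ico η (dkOrder η * η)) := by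
  have hint : ∀ a b : ℝ, IntervalIntegrable (dkKernel η) volume a b := fun a b =>
    ⟨(locBdd_dkKernel hη).integrableOn_Ioc a b, (locBdd_dkKernel hη).integrableOn_Ioc b a⟩
  have hF : Continuous fun x => ∫ s in (0:ℝ)..x, dkKernel η s :=
    intervalIntegral.continuous_primitive hint 0
  have hG : Continuous fun t => 1 - ∫ s in (0:ℝ)..(t - η), dkKernel η s :=
    continuous_const.sub (hF.comp (continuous_id.sub continuous_const))
  refine hG.continuousOn.congr fun t ht => ?_
  show dkB η t = 1 - ∫ s in (0:ℝ)..(t - η), dkKernel η s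
  rw [dkB_eq_one_sub hη ht.1 ht.2, intervalIntegral.integral_of_le (by linarith [ht.1])]

/-- **`b_η > 0` on `[η, 3]`** (first-zero argument on the Dickman form). [folklore] -/
theorem dkB_pos (hη : 0 < η) : ∀ t ∈ Set.Icc η 3, 0 < dkB η t := by
  intro t₀ ht₀
  by_contra hb₀'
  have hb₀ : dkB η t₀ ≤ 0 := not_lt.1 hb₀'
  have hW := three_lt_window hη
  -- `t₀ ≥ 2η` since `b = 1` on `[η, 2η)`
  have ht₀2 : 2 * η ≤ t₀ := by
    by_contra h
    rw [dkB_of_lt_two_mul hη ht₀.1 (not_le.1 h)] at hb₀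
    linarith
  set S : Set ℝ := Set.Icc (2 * η) 3 ∩ (dkB η) ⁻¹' Set.Iic 0 with hS
  have hcont : ContinuousOn (dkB η) (Set.Icc (2 * η) 3) :=
    (continuousOn_dkB hη).mono fun t ht => ⟨by linarith [ht.1], lt_of_le_of_lt ht.2 hW⟩
  have hSclosed : IsClosed S := hcont.preimage_isClosed_of_isClosed isClosed_Icc isClosed_Iic
  have hSne : S.Nonempty := ⟨t₀, ⟨ht₀2, ht₀.2⟩, hb₀⟩
  have hSbdd : BddBelow S := ⟨2 * η, fun t ht => ht.1.1⟩
  set t₁ := sInf S with ht₁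
  have ht₁S : t₁ ∈ S := hSclosed.csInf_mem hSne hSbdd
  have h2t₁ : 2 * η ≤ t₁ := ht₁S.1.1
  have ht₁3 : t₁ ≤ 3 := ht₁S.1.2
  have hbt₁ : dkB η t₁ ≤ 0 := ht₁S.2
  -- `b > 0` on `(t₁ - η, t₁)`
  have hpos : ∀ s ∈ Set.Ioo (t₁ - η) t₁, 0 < dkB η s := by
    intro s hs
    by_cases h2 : s < 2 * η
    · rw [dkB_of_lt_two_mul hη (by linarith [hs.1]) h2]; exact one_pos
    · by_contra hneg
      have hsS : s ∈ S := ⟨⟨not_lt.1 h2, by linarith [hs.2]⟩, not_lt.1 hneg⟩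
      exact absurd (csInf_le hSbdd hsS) (not_le.2 hs.2)
  -- the Dickman form at `t₁`
  have hD := sub_mul_dkB_eq_integral hη (by linarith) (lt_of_le_of_lt ht₁3 hW)
  rw [← intervalIntegral.integral_of_le (by linarith)] at hD
  have hint : IntervalIntegrable (dkB η) volume (t₁ - η) t₁ :=
    ⟨(locBdd_dkB hη).integrableOn_Ioc _ _, (locBdd_dkB hη).integrableOn_Ioc _ _⟩
  have hI : 0 < ∫ s in (t₁ - η)..t₁, dkB η s :=
    intervalIntegral.intervalIntegral_pos_of_pos_on hint hpos (by linarith)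
  have : (t₁ - η) * dkB η t₁ ≤ 0 := mul_nonpos_of_nonneg_of_nonpos (by linarith) hbt₁
  linarith

/-- `B_η ≥ 0` on `(−∞, 3]`. [folklore] -/
theorem dkKernel_nonneg (hη : 0 < η) {t : ℝ} (ht : t ≤ 3) : 0 ≤ dkKernel η t := by
  rcases lt_or_ge t η with h | h
  · rw [dkKernel_of_lt hη h]
  · have hb := dkB_pos hη t ⟨h, ht⟩
    rw [dkB] at hb
    exact (pos_of_mul_pos_right hb (hη.trans_le h).le).le  -- placeholder, fix if needed

/-- `b_η ≤ 1` on `[η, 3]`. [folklore] -/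
theorem dkB_le_one (hη : 0 < η) {t : ℝ} (h1 : η ≤ t) (h3 : t ≤ 3) : dkB η t ≤ 1 := by
  rw [dkB_eq_one_sub hη h1 (lt_of_le_of_lt h3 (three_lt_window hη)), sub_le_self_iff]
  exact setIntegral_nonneg measurableSet_Ioc fun s hs => dkKernel_nonneg hη (by linarith [hs.2])

/-- `B_η(t) ≤ 1/t ≤ 1/η` on `(−∞, 3]`. [folklore] -/
theorem dkKernel_le (hη : 0 < η) {t : ℝ} (ht : t ≤ 3) : dkKernel η t ≤ 1 / η := by
  rcases lt_or_ge t η with h | h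
  · rw [dkKernel_of_lt hη h]; positivity
  · have ht0 : 0 < t := hη.trans_le h
    have hb := dkB_le_one hη h ht
    rw [dkB] at hb
    calc dkKernel η t = t * dkKernel η t / t := by field_simp
      _ ≤ 1 / t := by gcongr
      _ ≤ 1 / η := one_div_le_one_div_of_le hη h

/-- `b_η` is non-increasing on `[η, 3]`. [folklore] -/
theorem dkB_antitoneOn (hη : 0 < η) : AntitoneOn (dkB η) (Set.Icc η 3) := by
  intro t ht t' ht' htt'
  have hW := three_lt_window hη
  rw [dkB_eq_one_sub hη ht.1 (lt_of_le_of_lt ht.2 hW),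
    dkB_eq_one_sub hη ht'.1 (lt_of_le_of_lt ht'.2 hW)]
  refine sub_le_sub_left (setIntegral_mono_set ((locBdd_dkKernel hη).integrableOn_Ioc _ _)
    ?_ (Filter.Eventually.of_forall (Set.Ioc_subset_Ioc_right (by linarith)))) 1
  exact (ae_restrict_iff' measurableSet_Ioc).2 (Filter.Eventually.of_forall fun s hs =>
    dkKernel_nonneg hη (by linarith [hs.2, ht'.2]))


/-- **`∫_{0<s≤X} B_η ≤ 1`** for `X ≤ 3 − η` (`= 1 − b_η(X + η)`). [folklore] -/
theorem setIntegral_dkKernel_le_one (hη : 0 < η) {X : ℝ} (hX : X ≤ 3 - η) :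
    ∫ s in Set.Ioc 0 X, dkKernel η s ≤ 1 := by
  rcases le_or_gt X 0 with h | h
  · rw [Set.Ioc_eq_empty (not_lt.2 h), Measure.restrict_empty, integral_zero_measure]
    exact zero_le_one
  · have h1 : η ≤ X + η := by linarith
    have hb := dkB_eq_one_sub hη h1 (by linarith [three_lt_window hη])
    rw [add_sub_cancel_right] at hb
    have hpos := dkB_pos hη (X + η) ⟨h1, by linarith⟩
    linarith

/-- The integral of `B_η` over any `(0, X]`, `X ≤ 3 − η`, is non-negative. [folklore] -/
theorem setIntegral_dkKernel_nonneg (hη : 0 < η) {X : ℝ} (hX : X ≤ 3) :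
    0 ≤ ∫ s in Set.Ioc 0 X, dkKernel η s :=
  setIntegral_nonneg measurableSet_Ioc fun _ hs => dkKernel_nonneg hη (hs.2.trans hX)

/-- Decay, first step: `b_η(t) ≤ η b_η(t − η)/(t − η)` for `2η ≤ t ≤ 3`. [folklore] -/
theorem dkB_le_step (hη : 0 < η) {t : ℝ} (h2 : 2 * η ≤ t) (h3 : t ≤ 3) :
    dkB η t ≤ η * dkB η (t - η) / (t - η) := by
  have hW := three_lt_window hη
  have hD := sub_mul_dkB_eq_integral hη (by linarith) (lt_of_le_of_lt h3 hW)
  -- `∫_{t-η}^{t} b ≤ η b(t-η)` by monotonicity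
  have hbound : ∫ s in Set.Ioc (t - η) t, dkB η s ≤ ∫ _ in Set.Ioc (t - η) t, dkB η (t - η) := by
    refine setIntegral_mono_on ((locBdd_dkB hη).integrableOn_Ioc _ _)
      (integrableOn_const (by rw [Real.volume_Ioc]; exact ENNReal.ofReal_ne_top)) measurableSet_Ioc
      fun s hs => ?_
    exact dkB_antitoneOn hη ⟨by linarith, by linarith⟩ ⟨by linarith [hs.1], hs.2.trans h3⟩ hs.1.le
  rw [setIntegral_const, Measure.real, Real.volume_Ioc, ENNReal.toReal_ofReal (by linarith),
    smul_eq_mul, show t - (t - η) = η by ring] at hbound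
  rw [le_div_iff₀ (by linarith), mul_comm (dkB η t)]
  linarith

/-- **Decay of the kernel**: `B_η(t) ≤ η² / (t (t − η)(t − 2η))` for `3η ≤ t ≤ 3`. [folklore] -/
theorem dkKernel_le_decay (hη : 0 < η) {t : ℝ} (h3 : 3 * η ≤ t) (h3' : t ≤ 3) :
    dkKernel η t ≤ η ^ 2 / (t * (t - η) * (t - 2 * η)) := by
  have ht0 : 0 < t := by linarith
  have s1 := dkB_le_step hη (by linarith) h3'
  have s2 := dkB_le_step hη (t := t - η) (by linarith) (by linarith)
  have hb1 : dkB η (t - η - η) ≤ 1 := dkB_le_one hη (by linarith) (by linarith)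
  have hpos1 : 0 < t - η := by linarith
  have hpos2 : 0 < t - η - η := by linarith
  have hbpos : 0 ≤ dkB η (t - η - η) := (dkB_pos hη _ ⟨by linarith, by linarith⟩).le
  -- `b(t) ≤ η/(t-η) · η/(t-2η)`
  have hbt : dkB η t ≤ η ^ 2 / ((t - η) * (t - 2 * η)) := by
    calc dkB η t ≤ η * dkB η (t - η) / (t - η) := s1
      _ ≤ η * (η * dkB η (t - η - η) / (t - η - η)) / (t - η) := by gcongr
      _ ≤ η * (η * 1 / (t - η - η)) / (t - η) := by gcongr
      _ = η ^ 2 / ((t - η) * (t - 2 * η)) := by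
          have h1 : t - η ≠ 0 := by linarith
          have h2 : t - 2 * η ≠ 0 := by linarith
          rw [show t - η - η = t - 2 * η by ring]
          field_simp
  rw [dkB] at hbt
  have hden : 0 < (t - η) * (t - 2 * η) := mul_pos hpos1 (by linarith)
  rw [le_div_iff₀ (mul_pos (mul_pos ht0 hpos1) (by linarith))]
  rw [le_div_iff₀ hden] at hbt
  nlinarith

/-- **`b_η` is `1/η`-Lipschitz on `[η, 3]`.** [folklore] -/
theorem abs_dkB_sub_le (hη : 0 < η) {t t' : ℝ} (ht : t ∈ Set.Icc η 3) (ht' : t' ∈ Set.Icc η 3) :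
    |dkB η t - dkB η t'| ≤ (1 / η) * |t - t'| := by
  have hW := three_lt_window hη
  wlog h : t' ≤ t generalizing t t'
  · rw [abs_sub_comm, abs_sub_comm t]
    exact this ht' ht (not_le.1 h).le
  rw [dkB_eq_one_sub hη ht.1 (lt_of_le_of_lt ht.2 hW), dkB_eq_one_sub hη ht'.1 (lt_of_le_of_lt ht'.2 hW)]
  have hsplit : ∫ s in Set.Ioc 0 (t - η), dkKernel η s =
      (∫ s in Set.Ioc 0 (t' - η), dkKernel η s) + ∫ s in Set.Ioc (t' - η) (t - η), dkKernel η s := by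
    rw [← setIntegral_union (Set.Ioc_disjoint_Ioc_of_le le_rfl) measurableSet_Ioc
      ((locBdd_dkKernel hη).integrableOn_Ioc _ _) ((locBdd_dkKernel hη).integrableOn_Ioc _ _),
      Set.Ioc_union_Ioc_eq_Ioc (by linarith [ht'.1]) (by linarith)]
  rw [hsplit]
  have hI : |∫ s in Set.Ioc (t' - η) (t - η), dkKernel η s| ≤ (1 / η) * (t - t') := by
    have hb : ∀ s ∈ Set.Ioc (t' - η) (t - η), ‖dkKernel η s‖ ≤ 1 / η := fun s hs => by
      rw [Real.norm_eq_abs, abs_of_nonneg (dkKernel_nonneg hη (by linarith [hs.2, ht.2]))]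
      exact dkKernel_le hη (by linarith [hs.2, ht.2])
    have := norm_setIntegral_le_of_norm_le_const (measure_Ioc_lt_top (μ := volume)) hb
    rw [Real.norm_eq_abs, Measure.real, Real.volume_Ioc, ENNReal.toReal_ofReal (by linarith)] at this
    calc |∫ s in Set.Ioc (t' - η) (t - η), dkKernel η s| ≤ 1 / η * (t - η - (t' - η)) := this
      _ = 1 / η * (t - t') := by ring
  rw [abs_of_nonneg (by linarith : 0 ≤ t - t')]
  calc |1 - ((∫ s in Set.Ioc 0 (t' - η), dkKernel η s) + ∫ s in Set.Ioc (t' - η) (t - η), dkKernel η s)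
          - (1 - ∫ s in Set.Ioc 0 (t' - η), dkKernel η s)|
        = |∫ s in Set.Ioc (t' - η) (t - η), dkKernel η s| := by
          rw [show (1:ℝ) - ((∫ s in Set.Ioc 0 (t' - η), dkKernel η s)
              + ∫ s in Set.Ioc (t' - η) (t - η), dkKernel η s)
              - (1 - ∫ s in Set.Ioc 0 (t' - η), dkKernel η s)
              = -∫ s in Set.Ioc (t' - η) (t - η), dkKernel η s by ring, abs_neg]
    _ ≤ 1 / η * (t - t') := hI

/-- **`B_η` is Lipschitz on `[η, 3]`** with constant `2/η²`. [folklore] -/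
theorem abs_dkKernel_sub_le (hη : 0 < η) {t t' : ℝ} (ht : t ∈ Set.Icc η 3) (ht' : t' ∈ Set.Icc η 3) :
    |dkKernel η t - dkKernel η t'| ≤ (2 / η ^ 2) * |t - t'| := by
  have ht0 : 0 < t := hη.trans_le ht.1
  have ht0' : 0 < t' := hη.trans_le ht'.1
  have hB : dkKernel η t = dkB η t / t := by rw [dkB]; field_simp
  have hB' : dkKernel η t' = dkB η t' / t' := by rw [dkB]; field_simp
  have hb1 : |dkB η t'| ≤ 1 := by
    rw [abs_of_nonneg (dkB_pos hη t' ht').le]; exact dkB_le_one hη ht'.1 ht'.2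
  rw [hB, hB']
  have hdecomp : dkB η t / t - dkB η t' / t' = (dkB η t - dkB η t') / t + dkB η t' * (t' - t) / (t * t') := by
    field_simp
    ring
  rw [hdecomp]
  calc |(dkB η t - dkB η t') / t + dkB η t' * (t' - t) / (t * t')|
      ≤ |(dkB η t - dkB η t') / t| + |dkB η t' * (t' - t) / (t * t')| := abs_add_le _ _
    _ = |dkB η t - dkB η t'| / t + |dkB η t'| * |t - t'| / (t * t') := by
        rw [abs_div, abs_div, abs_mul, abs_of_pos ht0, abs_of_pos (mul_pos ht0 ht0'),
          abs_sub_comm t' t]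
    _ ≤ (1 / η * |t - t'|) / η + 1 * |t - t'| / (η * η) := by
        refine add_le_add ?_ ?_
        · exact div_le_div₀ (by positivity) (abs_dkB_sub_le hη ht ht') hη ht.1
        · exact div_le_div₀ (by positivity) (mul_le_mul_of_nonneg_right hb1 (abs_nonneg _))
            (mul_pos hη hη) (mul_le_mul ht.1 ht'.1 hη.le ht0.le)
    _ = 2 / η ^ 2 * |t - t'| := by field_simp; ring

end Kernel

end Literature.Analysis.Convolution
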